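import Literature.AlgebraicGeometry.ComplexMultiplication.AndreProductFormBiproduct
import Literature.AlgebraicGeometry.ComplexMultiplication.WeilLineClassesInWeilClassesField
import Literature.AlgebraicGeometry.Deligne1982.ConstantSumSplitHermitianForm
import Literature.AlgebraicGeometry.Deligne1982.WeilTypeCMDiscriminant
import Literature.AlgebraicGeometry.Deligne1982.WeilTypeCMOfCMField
import HarnessLib

/-!
# André 1992 in Milne's split form, I: André's constant-sum slot products are of WEIL TYPE, and Deligne's presentation
# `E = ℚ[T]/(R(T²))` at a purely imaginary separating generator

Part 1 (`AndreSplitWeilType`): for realisations `A_j` of CM types `Ψ_j` (`j < d`) of one CM field `K` with CONSTANT indicator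
sum `#{j : s ∈ Ψ_j} = d/2` for every embedding `s`, the diagonal action of an integral separating `a₀` on `⨁_j A_j` has all
eigen-multiplicities `d/2` on `H^{1,0}` — the product is of Weil type for `(ℚ(a₀), act(a₀))` (Milne 2020 §2, 2.1–2.2;
Moonen–Zarhin §1: `n_σ + n_σ̄ = 2g/[F:ℚ]`) (`eigenMultiplicity_diagHom_eq_card`, `isWeilTypeCM_of_constantSum`).
Part 2 (`AndreSplitWeilTypeGenerator`): a purely IMAGINARY integral separating element `b₀` of a CM field (`exists_imaginary_separating`),
its minimal polynomial is `R(T²)` (`exists_sq_eq_minpoly`) — Deligne's presentation of the Weil field, LNM 900 §5 (c) —,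
and the Weil type of the diagonal action of `b₀` (`isWeilTypeCM_diagHom`).

Provenance: Literature home (namespace `Literature.AlgebraicGeometry.ComplexMultiplication.AndreSplit`) of the Summits-side
`CorCM/AndreSplitWeilType` and `CorCM/AndreSplitWeilTypeGenerator` (imports `Literature/` and Mathlib only), re-homed for the
Literature-side discharge of `HodgeTheory.Andre1992_hodgeClasses_cmType_mem_span_pullback_splitWeilClassesCM`. No case of the
Hodge conjecture is asserted. Lane `lit-hodgefound` (Layer A3/A4), seat p20.

## References
* [Milne2020HodgeClassesAV] J. S. Milne, *Hodge classes on abelian varieties* (2020), §2 (2.1)–(2.2), §3 Thm. 1.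
* [Deligne1982HodgeCycles] P. Deligne (notes by J. S. Milne), LNM 900 (1982), §4 Cor. 4.2, §5 (c) (pp. 38–39).
* [MoonenZarhin1998WeilClasses] B. Moonen, Yu. Zarhin, J. reine angew. Math. 496 (1998), §1.
* [Andre1992HodgeCM] Y. André, *Une remarque à propos des cycles de Hodge de type CM* (1992), Théorème.
-/

noncomputable section

namespace Literature.AlgebraicGeometry.ComplexMultiplication.AndreSplit

/-! ## Part 1: constant-sum slot products are of Weil type -/

section Part1

open _root_.CategoryTheory _root_.CategoryTheory.Limits Polynomial NumberField
open Literature.AlgebraicGeometry Literature.AlgebraicGeometry.Motives Literature.AlgebraicGeometry.HodgeTheory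
open Literature.AlgebraicGeometry.ComplexMultiplication Literature.AlgebraicGeometry.Deligne1982
open Literature.NumberTheory.QuadraticForms (Landherr.posCount)
open Literature.NumberTheory.Automorphic.PicardCM (eigenline)
open Literature.AlgebraicGeometry.ComplexMultiplication.AndreProductForm Literature.AlgebraicGeometry.ComplexMultiplication.Milne2020

variable (K : Type) [Field K] [NumberField K]

/-! ## The multiplicities of André's diagonal action: `n_{s(a₀)} = #{j | s ∈ Ψ_j}` -/

open scoped Classical in
/-- **`n_{s(a₀)} = #{j | s ∈ Ψ_j}`** (Deligne's "`a_s = Σᵢ Φᵢ(s)`" for the biproduct of realisations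
`(B_j, Ψ_j)` with the diagonal action of `𝓞_K`, read through an integer `a₀` separating the complex
embeddings): the multiplicity of the eigenvalue `s(a₀)` of `act(a₀)^*` on `H^{1,0}(⨁ B)` equals the number of
slots `j` with `s ∈ Ψ_j`.  [cite: Deligne1982HodgeCycles, §5 (c) p. 38]
[cite: MoonenZarhin1998WeilClasses, §1 (n_σ + n_σ' = 2g/[F:ℚ])] -/
theorem eigenMultiplicity_diagHom_eq_card {d : ℕ} (B : Fin d → AbelianVariety ℂ)
    (act : ∀ j, 𝓞 K →+* End (B j)) {θB : ∀ j, K →+* Module.End ℂ (complexBetti (B j).X 1)}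
    {Ψ : Fin d → CMType K} (hB : ∀ j, IsCMTypeRealisation (Ψ j) (B j) (act j) (θB j))
    (a₀ : 𝓞 K) (hsep : Function.Injective fun σ : K →+* ℂ => σ (a₀ : K)) (s : K →+* ℂ) :
    eigenMultiplicity (⨁ B) (diagHom K B act a₀) (s (a₀ : K)) =
      (Finset.univ.filter fun j : Fin d => s ∈ (Ψ j).1).card := by
  have hv : ∀ j, ∃ v : Module.Basis (K →+* ℂ) ℂ (complexBetti (B j).X 1), ∀ σ, v σ ∈ eigenline (θB j) σ :=
    fun j => exists_eigenbasis (hB j)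
  choose vB hvB using hv
  obtain ⟨hPm, hPirr, hPe, hroot, -⟩ := minpoly_facts K a₀ hsep
  have hφP := eval₂_diagHom_minpoly K B act a₀
  have her : Module.finrank ℚ K * d = 2 * (⨁ B).dim := by
    rw [two_mul_dim_biproduct B vB, Fintype.card_fin, ← NumberField.Embeddings.card K ℂ, mul_comm]
  have h1 := card_filter_le_eigenMultiplicity K B act hB hvB a₀ s
  have h2 := card_filter_le_eigenMultiplicity K B act hB hvB a₀ (ComplexEmbedding.conjugate s)
  rw [ComplexEmbedding.conjugate_coe_eq] at h2
  have h3 := card_filter_conjugate K Ψ s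
  have hsum := eigenMultiplicity_add_eigenMultiplicity_conj_eq hPm hPe hPirr hφP her (hroot s)
  omega

/-! ## Weil type on Deligne's carriers -/

open scoped Classical in
/-- **André's constant-sum products are of Weil type on Deligne's carriers** (Deligne §5 (c): "the
assumption that `Σ Φᵢ =` constant therefore implies that `a_s = b_s = d/2`, all `s`", i.e. (4.4) holds;
Milne 2020 2.2, Weil-type half).  For `K` a Galois CM field with `2 < [K:ℚ]`, realisations `(B_j, Ψ_j)`,
`j < d = 2p`, with `#{j | s ∈ Ψ_j} = p` for every `s`, and an integer `a₀` separating the embeddings, there are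
`S, R ∈ ℤ[T]`, `e₀ = [K:ℚ]/2` and `η = S(act(a₀)) ∈ End(⨁ B)` with `Deligne1982.IsWeilTypeCM (⨁ B) η R e₀ p`
(`E = ℚ(η) ≅ ℚ[T]/(R(T²))` a CM field of degree `2e₀`, `η̄ = -η`, `dim ⨁B = 2pe₀`, every multiplicity `= p`),
all multiplicities of `η` equal to `p`, and the same complexified Weil space as `(act(a₀), minpoly a₀)`.
[cite: Deligne1982HodgeCycles, §4 Prop. 4.4 and §5 (c) pp. 38–39] [cite: Milne2020HodgeClassesAV, 2.2] -/
theorem exists_isWeilTypeCM_of_constantSum [IsCMField K] [IsGalois ℚ K] (hK : 2 < Module.finrank ℚ K)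
    {d p : ℕ} (hd : d = 2 * p) (hp : 0 < p) (B : Fin d → AbelianVariety ℂ)
    (act : ∀ j, 𝓞 K →+* End (B j)) {θB : ∀ j, K →+* Module.End ℂ (complexBetti (B j).X 1)}
    {Ψ : Fin d → CMType K} (hB : ∀ j, IsCMTypeRealisation (Ψ j) (B j) (act j) (θB j))
    (hadm : ∀ s : K →+* ℂ, (Finset.univ.filter fun j : Fin d => s ∈ (Ψ j).1).card = p)
    (a₀ : 𝓞 K) (hsep : Function.Injective fun σ : K →+* ℂ => σ (a₀ : K)) :
    ∃ (S R : Polynomial ℤ) (e₀ : ℕ) (η : ⨁ B ⟶ ⨁ B), Module.finrank ℚ K = 2 * e₀ ∧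
      (η : CategoryTheory.End (⨁ B)) =
        Polynomial.eval₂ (Int.castRingHom (CategoryTheory.End (⨁ B)))
          (diagHom K B act a₀ : CategoryTheory.End (⨁ B)) S ∧
      IsWeilTypeCM (⨁ B) η R e₀ p ∧
      (∀ ρ : ℂ, Polynomial.eval₂ (Int.castRingHom ℂ) ρ (minpoly ℤ a₀) = 0 →
        eigenMultiplicity (⨁ B) η (Polynomial.eval₂ (Int.castRingHom ℂ) ρ S) = p) ∧
      ∀ r : ℕ, weilClassesField (⨁ B) η (R.comp (X ^ 2)) r =
        weilClassesField (⨁ B) (diagHom K B act a₀) (minpoly ℤ a₀) r := by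
  have hv : ∀ j, ∃ v : Module.Basis (K →+* ℂ) ℂ (complexBetti (B j).X 1), ∀ σ, v σ ∈ eigenline (θB j) σ :=
    fun j => exists_eigenbasis (hB j)
  choose vB hvB using hv
  obtain ⟨hPm, hPe, -, hPirr, hnr, hQ, -⟩ := isGaloisCMFieldPoly_minpoly K a₀ hsep
  have hroot := (minpoly_facts K a₀ hsep).2.2.2.1
  have hφ := eval₂_diagHom_minpoly K B act a₀
  have hdim : Module.finrank ℚ K * (2 * p) = 2 * (⨁ B).dim := by
    rw [two_mul_dim_biproduct B vB, Fintype.card_fin, hd, ← NumberField.Embeddings.card K ℂ, mul_comm]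
  have hmult : ∀ ρ : ℂ, Polynomial.eval₂ (Int.castRingHom ℂ) ρ (minpoly ℤ a₀) = 0 →
      eigenMultiplicity (⨁ B) (diagHom K B act a₀) ρ = p := by
    intro ρ hρ
    obtain ⟨s, rfl⟩ := exists_embedding_of_root K a₀ hρ
    rw [eigenMultiplicity_diagHom_eq_card K B act hB a₀ hsep s, hadm s]
  have hbal : ∀ ρ : ℂ, Polynomial.eval₂ (Int.castRingHom ℂ) ρ (minpoly ℤ a₀) = 0 →
      eigenMultiplicity (⨁ B) (diagHom K B act a₀) ρ =
        eigenMultiplicity (⨁ B) (diagHom K B act a₀) (starRingEnd ℂ ρ) := by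
    intro ρ hρ
    obtain ⟨s, rfl⟩ := exists_embedding_of_root K a₀ hρ
    rw [hmult _ hρ, ← ComplexEmbedding.conjugate_coe_eq, hmult _ (hroot _)]
  obtain ⟨S, R, e₀, η, he, hη, hW, -, -, hmul, hweil⟩ :=
    exists_isWeilTypeCM_of_cmField hPm hPe hK hPirr hφ hdim hp hnr hQ hbal
  exact ⟨S, R, e₀, η, he, hη, hW, fun ρ hρ => by rw [hmul ρ hρ, hmult ρ hρ], hweil⟩

/-! ## Milne 2020 2.2: the Weil-type datum and the split hermitian form -/

open scoped Classical in
/-- **Milne 2020 2.2 / Deligne §5 (c) — the two halves that are theorems of the tree**, for André's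
constant-sum products over a Galois CM field `K` with `2 < [K:ℚ]`: (a) the Weil-type datum
`IsWeilTypeCM (⨁ B) η R e₀ p` of `exists_isWeilTypeCM_of_constantSum`; (b) (Literature
`Deligne1982.exists_split_hermitianForm_of_constantSum_cmTypes`) purely imaginary Riemann-form generators
`ζ_j ∈ K` of the CM types `Ψ_j` (`τ ∈ Ψ_j ↔ Im τ(ζ_j) > 0`) and TOTALLY POSITIVE `f_j ∈ K⁺` such that the
`K`-hermitian form `⟨f_j ζ_j/ζ_{j₀}⟩` (Deligne's `φ`, with `Tr(ζ_{j₀} φ) = Σ f_j ψ_j` the Riemann form of the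
product polarization) has positive index `p` at every complex place, discriminant `∏ f_j ζ_j/ζ_{j₀} = (-1)^p`,
and a totally isotropic `K`-subspace of dimension `p` — "`A`, equipped with the diagonal action of `F`, is of
split Weil type", up to the identification of `Σ f_j ψ_j` with a hyperplane class of `⨁ B` (not here).
[cite: Milne2020HodgeClassesAV, 2.2] [cite: Deligne1982HodgeCycles, §5 (c) pp. 38–39, §4 Cor. 4.2]
[cite: CharlesSchnell2014Notes, Prop. 11.5.22] -/
theorem weilType_and_splitForm_of_constantSum [IsCMField K] [IsGalois ℚ K] (hK : 2 < Module.finrank ℚ K)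
    {d p : ℕ} (hd : d = 2 * p) (hp : 0 < p) (B : Fin d → AbelianVariety ℂ)
    (act : ∀ j, 𝓞 K →+* End (B j)) {θB : ∀ j, K →+* Module.End ℂ (complexBetti (B j).X 1)}
    {Ψ : Fin d → CMType K} (hB : ∀ j, IsCMTypeRealisation (Ψ j) (B j) (act j) (θB j))
    (hadm : ∀ s : K →+* ℂ, (Finset.univ.filter fun j : Fin d => s ∈ (Ψ j).1).card = p)
    (a₀ : 𝓞 K) (hsep : Function.Injective fun σ : K →+* ℂ => σ (a₀ : K)) (j₀ : Fin d) :
    (∃ (S R : Polynomial ℤ) (e₀ : ℕ) (η : ⨁ B ⟶ ⨁ B), Module.finrank ℚ K = 2 * e₀ ∧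
      (η : CategoryTheory.End (⨁ B)) =
        Polynomial.eval₂ (Int.castRingHom (CategoryTheory.End (⨁ B)))
          (diagHom K B act a₀ : CategoryTheory.End (⨁ B)) S ∧
      IsWeilTypeCM (⨁ B) η R e₀ p) ∧
    ∃ ζ f : Fin d → K,
      (∀ j, IsCMField.complexConj K (ζ j) = -ζ j) ∧
      (∀ j (τ : K →+* ℂ), τ ∈ (Ψ j).1 ↔ 0 < (τ (ζ j)).im) ∧
      (∀ j, IsCMField.complexConj K (f j) = f j) ∧ (∀ j (τ : K →+* ℂ), 0 < (τ (f j)).re) ∧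
      (∀ j (τ : K →+* ℂ), τ ∈ (Ψ j).1 ↔ 0 < (τ (f j * ζ j)).im) ∧
      (∀ τ : K →+* ℂ, Landherr.posCount K τ (fun j => f j * (ζ j / ζ j₀)) = p) ∧
      (∏ j, f j * (ζ j / ζ j₀) = (-1) ^ p) ∧
      ∃ W : Submodule K (Fin d → K), Module.finrank K W = p ∧
        ∀ v ∈ W, ∀ w ∈ W,
          ∑ j, f j * (ζ j / ζ j₀) * (IsCMField.complexConj K (v j) * w j) = 0 := by
  refine ⟨?_, ?_⟩
  · obtain ⟨S, R, e₀, η, he, hη, hW, -, -⟩ :=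
      exists_isWeilTypeCM_of_constantSum K hK hd hp B act hB hadm a₀ hsep
    exact ⟨S, R, e₀, η, he, hη, hW⟩
  · have hζ : ∀ j, ∃ ζ : K, IsCMField.complexConj K ζ = -ζ ∧ ζ ≠ 0 ∧
        ∀ τ : K →+* ℂ, τ ∈ (Ψ j).1 ↔ 0 < (τ ζ).im := fun j => SplitCriterion.exists_skew_adapted (Ψ j)
    choose ζ hζ _hζ0 hadapt using hζ
    obtain ⟨-, f, hf, hfpos, hkeep, hsig, hprod, W, hW, hiso⟩ :=
      exists_split_hermitianForm_of_constantSum_cmTypes Ψ ζ hζ hadapt hadm j₀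
    exact ⟨ζ, f, hζ, hadapt, hf, hfpos, hkeep, hsig, hprod, W, hW, hiso⟩

end Part1

/-! ## Part 2: Deligne's presentation at a purely imaginary separating generator -/

section Part2

open _root_.CategoryTheory _root_.CategoryTheory.Limits Polynomial NumberField
open Literature.AlgebraicGeometry Literature.AlgebraicGeometry.Motives Literature.AlgebraicGeometry.HodgeTheory
open Literature.AlgebraicGeometry.ComplexMultiplication Literature.AlgebraicGeometry.Deligne1982
open Literature.NumberTheory.Automorphic.PicardCM (eigenline)
open Literature.AlgebraicGeometry.ComplexMultiplication.AndreProductForm Literature.AlgebraicGeometry.ComplexMultiplication.Milne2020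

/-! ## §1 A purely imaginary separating integer and Deligne's presentation `E = ℚ(b₀)`, `P = R(T²)` -/

section Arithmetic

variable (K : Type) [Field K] [NumberField K] [IsCMField K]

/-- **A purely imaginary algebraic integer separating the complex embeddings** of a CM field `K`: from a
separating integer `a₀` (`Milne2020.exists_integer_separating`) take `b₀ = (a₀ - ā₀)(a₀ + ā₀ + t)` with `t ∈ ℕ` off the
finitely many bad values (`Deligne1982.exists_nat_candidate_injOn`); then `b̄₀ = -b₀` and `σ ↦ σ(b₀)` is injective
(Deligne's generator `η` of `E = ℚ(η)` with `η̄ = -η`, chosen integral). [cite: Deligne1982HodgeCycles, §4 p. 30] -/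
theorem exists_imaginary_separating :
    ∃ b₀ : 𝓞 K, IsCMField.complexConj K (b₀ : K) = -(b₀ : K) ∧ Function.Injective fun σ : K →+* ℂ => σ (b₀ : K) := by
  classical
  obtain ⟨a₀, hsep⟩ := exists_integer_separating K
  let Z : Finset ℂ := Finset.univ.image fun σ : K →+* ℂ => σ (a₀ : K)
  have hZ : ∀ ρ ∈ Z, starRingEnd ℂ ρ ≠ ρ := by
    intro ρ hρ hfix
    obtain ⟨σ, -, rfl⟩ := Finset.mem_image.1 hρ
    refine IsTotallyComplex.complexEmbedding_not_isReal σ (ComplexEmbedding.isReal_iff.mpr (hsep ?_))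
    change ComplexEmbedding.conjugate σ (a₀ : K) = σ (a₀ : K)
    rw [ComplexEmbedding.conjugate_coe_eq]
    exact hfix
  obtain ⟨t, -, hinj⟩ := exists_nat_candidate_injOn Z hZ (N := 1) one_ne_zero
  set ab : 𝓞 K := IsCMField.ringOfIntegersComplexConj K a₀ with hab
  have habK : (ab : K) = IsCMField.complexConj K (a₀ : K) := IsCMField.coe_ringOfIntegersComplexConj K a₀
  refine ⟨(a₀ - ab) * (a₀ + ab + t), ?_, ?_⟩
  · have e : (((a₀ - ab) * (a₀ + ab + t) : 𝓞 K) : K) = ((a₀ : K) - ab) * ((a₀ : K) + ab + t) := by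
      push_cast; ring
    rw [e, map_mul, map_sub, map_add, map_add, habK, IsCMField.complexConj_apply_apply, map_natCast]
    ring
  · intro σ σ' hσσ'
    have hval : ∀ τ : K →+* ℂ, τ ((((a₀ - ab) * (a₀ + ab + t) : 𝓞 K) : K)) =
        ((1 : ℤ) * τ (a₀ : K) - (1 : ℤ) * starRingEnd ℂ (τ (a₀ : K))) *
          ((1 : ℤ) * τ (a₀ : K) + (1 : ℤ) * starRingEnd ℂ (τ (a₀ : K)) + (t : ℂ)) := by
      intro τ
      have e : (((a₀ - ab) * (a₀ + ab + t) : 𝓞 K) : K) = ((a₀ : K) - ab) * ((a₀ : K) + ab + t) := by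
        push_cast; ring
      rw [e, map_mul, map_sub, map_add, map_add, habK, IsCMField.complexEmbedding_complexConj, map_natCast]
      simp
    have h := hinj (σ (a₀ : K)) (Finset.mem_image.2 ⟨σ, Finset.mem_univ _, rfl⟩) (σ' (a₀ : K))
      (Finset.mem_image.2 ⟨σ', Finset.mem_univ _, rfl⟩)
    have hσσ'' : σ ((((a₀ - ab) * (a₀ + ab + t) : 𝓞 K) : K)) = σ' ((((a₀ - ab) * (a₀ + ab + t) : 𝓞 K) : K)) :=
      hσσ'
    rw [hval, hval] at hσσ''
    exact hsep (h hσσ'')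

variable {K}

/-- **Deligne's presentation `E = ℚ[T]/(R(T²))` for a purely imaginary separating integer.** For `K` a Galois CM
field and `b₀ ∈ 𝓞_K` purely imaginary separating the embeddings: `minpoly_ℤ(b₀) = R(T²)` with `R ∈ ℤ[S]` monic of degree
`e₀ = [K:ℚ]/2`, `P_R = R(T²)` irreducible over `ℚ` of degree `[K:ℚ]` with root `b₀`, all roots of `R` real negative, and
`P_R` a Galois CM field polynomial (`Milne2020.isGaloisCMFieldPoly_minpoly`; evenness by `Deligne1982.exists_even_minpoly`).
[cite: Deligne1982HodgeCycles, §4 p. 30 («E = ℚ(η) … η̄ = -η … F = ℚ(η²) totally real»)] [cite: Milne2020HodgeClassesAV, §2 2.1] -/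
theorem exists_sq_eq_minpoly [IsGalois ℚ K] {b₀ : 𝓞 K} (hb₀ : IsCMField.complexConj K (b₀ : K) = -(b₀ : K))
    (hsep : Function.Injective fun σ : K →+* ℂ => σ (b₀ : K)) :
    ∃ (R : Polynomial ℤ) (e₀ : ℕ), Module.finrank ℚ K = 2 * e₀ ∧ R.Monic ∧ R.natDegree = e₀ ∧
      R.comp (X ^ 2) = minpoly ℤ b₀ ∧ Irreducible (cmPolyQ R) ∧
      (∀ s : ℂ, Polynomial.eval₂ (Int.castRingHom ℂ) s R = 0 → s.im = 0 ∧ s.re < 0) ∧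
      Polynomial.aeval (b₀ : K) (cmPolyQ R) = 0 ∧ (cmPolyQ R).natDegree = Module.finrank ℚ K ∧
      IsGaloisCMFieldPoly (R.comp (X ^ 2)) (2 * e₀) := by
  obtain ⟨hPm, hPirr, hPe, hroot, -⟩ := minpoly_facts K b₀ hsep
  have hinj : ∀ ρ ρ' : ℂ, Polynomial.eval₂ (Int.castRingHom ℂ) ρ (minpoly ℤ b₀) = 0 →
      Polynomial.eval₂ (Int.castRingHom ℂ) ρ' (minpoly ℤ b₀) = 0 →
      Polynomial.eval₂ (Int.castRingHom ℂ) ρ X = Polynomial.eval₂ (Int.castRingHom ℂ) ρ' X → ρ = ρ' := by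
    intro ρ ρ' _ _ h
    simpa only [Polynomial.eval₂_X] using h
  have hodd : ∀ ρ : ℂ, Polynomial.eval₂ (Int.castRingHom ℂ) ρ (minpoly ℤ b₀) = 0 →
      starRingEnd ℂ (Polynomial.eval₂ (Int.castRingHom ℂ) ρ X) = -Polynomial.eval₂ (Int.castRingHom ℂ) ρ X := by
    intro ρ hρ
    obtain ⟨σ, rfl⟩ := exists_embedding_of_root K b₀ hρ
    rw [Polynomial.eval₂_X, ← IsCMField.complexEmbedding_complexConj, hb₀, map_neg]
  have hnr : ∀ ρ : ℂ, Polynomial.eval₂ (Int.castRingHom ℂ) ρ (minpoly ℤ b₀) = 0 → starRingEnd ℂ ρ ≠ ρ := by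
    intro ρ hρ hfix
    obtain ⟨σ, rfl⟩ := exists_embedding_of_root K b₀ hρ
    refine IsTotallyComplex.complexEmbedding_not_isReal σ (ComplexEmbedding.isReal_iff.mpr (hsep ?_))
    change ComplexEmbedding.conjugate σ (b₀ : K) = σ (b₀ : K)
    rw [ComplexEmbedding.conjugate_coe_eq]
    exact hfix
  obtain ⟨R, e₀, he, hRm, hRdeg, hRirr, hRroots, hdvd, -⟩ := exists_even_minpoly hPm hPe hPirr hinj hodd hnr
  rw [Polynomial.comp_X] at hdvd
  have hRcm : (R.comp (X ^ 2)).Monic := hRm.comp (Polynomial.monic_X_pow 2) (by rw [Polynomial.natDegree_X_pow]; norm_num)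
  have hRcdeg : (R.comp (X ^ 2)).natDegree = 2 * e₀ := by
    rw [Polynomial.natDegree_comp, hRdeg, Polynomial.natDegree_X_pow, mul_comm]
  have heq : R.comp (X ^ 2) = minpoly ℤ b₀ :=
    Polynomial.eq_of_monic_of_dvd_of_natDegree_le hPm hRcm hdvd (by rw [hRcdeg, hPe, he])
  have hdegQ : (cmPolyQ R).natDegree = Module.finrank ℚ K := by
    rw [cmPolyQ, Polynomial.natDegree_map_eq_of_injective (Int.castRingHom ℚ).injective_int, hRcdeg, he]
  refine ⟨R, e₀, he, hRm, hRdeg, heq, hRirr, hRroots, ?_, hdegQ, ?_⟩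
  · rw [cmPolyQ, heq, minpoly_int_map_eq]
    exact minpoly.aeval ℚ (b₀ : K)
  · rw [heq, ← he]
    exact isGaloisCMFieldPoly_minpoly K b₀ hsep

end Arithmetic

/-! ## §2 Weil type of André's constant-sum products for the diagonal action of a separating integer (no generator change) -/

section WeilType

variable (K : Type) [Field K] [NumberField K]

open scoped Classical in
/-- **Weil type on Deligne's carriers for `η = act(b₀)` ITSELF** (no change of generator): for `K` a Galois CM field,
realisations `(B_j, Ψ_j)`, `j < d = 2p`, with CONSTANT SUM `#{j | s ∈ Ψ_j} = p`, and `b₀ ∈ 𝓞_K` separating the embeddings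
with `minpoly_ℤ(b₀) = R(T²)` as in `exists_sq_eq_minpoly`, the diagonal endomorphism `η = ⊕_j act_j(b₀)` of `⨁ B` satisfies
`Deligne1982.IsWeilTypeCM (⨁ B) η R e₀ p`: `R(T²)(η) = 0` (`Milne2020.eval₂_diagHom_minpoly`), `dim ⨁B = 2p·e₀`
(`AndreProductForm.two_mul_dim_biproduct`), and every multiplicity equals `p` (`eigenMultiplicity_diagHom_eq_card` and the
constant sum: Deligne's «`a_s = Σᵢ Φᵢ(s)` … `a_s = b_s = d/2`»). [cite: Deligne1982HodgeCycles, §4 Prop. 4.4 and §5 (c) p. 38]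
[cite: Milne2020HodgeClassesAV, §2 2.2 (Weil-type half)] -/
theorem isWeilTypeCM_diagHom [IsCMField K] [IsGalois ℚ K]
    {d p : ℕ} (hd : d = 2 * p) (hp : 0 < p) (B : Fin d → AbelianVariety ℂ)
    (act : ∀ j, 𝓞 K →+* End (B j)) {θB : ∀ j, K →+* Module.End ℂ (complexBetti (B j).X 1)}
    {Ψ : Fin d → CMType K} (hB : ∀ j, IsCMTypeRealisation (Ψ j) (B j) (act j) (θB j))
    (hadm : ∀ s : K →+* ℂ, (Finset.univ.filter fun j : Fin d => s ∈ (Ψ j).1).card = p)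
    (b₀ : 𝓞 K) (hsep : Function.Injective fun σ : K →+* ℂ => σ (b₀ : K))
    {R : Polynomial ℤ} {e₀ : ℕ} (he : Module.finrank ℚ K = 2 * e₀) (hRm : R.Monic) (hRdeg : R.natDegree = e₀)
    (hR : R.comp (X ^ 2) = minpoly ℤ b₀) (hirr : Irreducible (cmPolyQ R))
    (hroots : ∀ s : ℂ, Polynomial.eval₂ (Int.castRingHom ℂ) s R = 0 → s.im = 0 ∧ s.re < 0) :
    IsWeilTypeCM (⨁ B) (diagHom K B act b₀) R e₀ p := by
  subst hd
  have hv : ∀ j, ∃ v : Module.Basis (K →+* ℂ) ℂ (complexBetti (B j).X 1), ∀ σ, v σ ∈ eigenline (θB j) σ :=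
    fun j => exists_eigenbasis (hB j)
  choose vB hvB using hv
  have hfin : 0 < Module.finrank ℚ K := Module.finrank_pos
  have hdim : Module.finrank ℚ K * (2 * p) = 2 * (⨁ B).dim := by
    rw [two_mul_dim_biproduct B vB, Fintype.card_fin, ← NumberField.Embeddings.card K ℂ, mul_comm]
  refine ⟨by omega, hp, hRm, hRdeg, hirr, hroots, ?_, ?_, ?_⟩
  · rw [hR]
    exact eval₂_diagHom_minpoly K B act b₀
  · rw [he] at hdim
    have e : 2 * (⨁ B).dim = 2 * (2 * p * e₀) := by rw [← hdim]; ring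
    exact Nat.eq_of_mul_eq_mul_left two_pos e
  · intro ρ hρ
    rw [hR] at hρ
    obtain ⟨s, rfl⟩ := exists_embedding_of_root K b₀ hρ
    rw [eigenMultiplicity_diagHom_eq_card K B act hB b₀ hsep s, hadm s]

end WeilType

end Part2

end Literature.AlgebraicGeometry.ComplexMultiplication.AndreSplit

end
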